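import Literature.MathematicalPhysics.QuantumFieldTheory.Sweep1ChatterjeeFreeEnergyProofs
import Literature.MathematicalPhysics.QuantumFieldTheory.LatticeGaugeAsymptoticsFreeEnergyProofs
import Literature.MathematicalPhysics.QuantumFieldTheory.WilsonEnergyConvexity
import HarnessLib

/-!
# SoloBlind: the mean plaquette of `U(N)` lattice gauge theory at weak coupling (`YangMills`)

The first rung ON THE WEAK-COUPLING SIDE of the ladder typed in `SoloBlindInfraredFrontier`:
a kernel-checked statement about the torus Wilson states `μ_{Λ_L, β}` of the summit
(`wilsonMeasure`, `wilsonExpectation`, `wilsonAction` of `ConstructiveQFTWave0`) in the regime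
`β → ∞` that the summit's weak-coupling limit `sch.HasWeakCouplingLimit` forces, valid UNIFORMLY IN
THE VOLUME in the only order of limits that matters there (`L → ∞` first, then `β → ∞`).

* `eventually_abs_mul_sub_le_of_supportingLines` — the real-analysis lever, stated abstractly:
  if finite-volume "free energies" `f_L(β)` converge to `f(β)` for every `β`, a quantity `E_L(β)`
  obeys the two supporting-line inequalities `(β - β') E_L(β) ≤ f_L(β') - f_L(β)` (i.e. `-E_L(β)`
  is a subgradient of the convex `f_L` at `β`), and `f(β) + c log β → K` as `β → ∞` with `c > 0`,
  then `β E_L(β) → c` in the iterated sense: `∀ ε > 0, ∀ᶠ β, ∀ᶠ L, |β E_L(β) - c| ≤ ε`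
  (Griffiths' lemma on derivatives of convex functions, in the scale-invariant form adapted to a
  logarithmic asymptote: relative steps `β' = (1 ± η) β`).
* `tendsto_freeEnergyDensity_add_log` — Chatterjee's leading term of the free energy in the TORUS
  normalisation and in every dimension `d ≥ 2`: for a unitary model `ρ : G →* M_N(ℂ)` (`G ≅ U(N)`,
  `N ≥ 1`), `f(β) + ½ (d-1) N² log β` converges as `β → ∞`, where
  `f(β) = lim_L L^{-d} log Z_{Λ_L, β}` is the torus free energy density (`freeEnergyDensity`).
  The tree proves Chatterjee's Theorem 2.1 for free-boundary cubes (`chatterjee_freeEnergy_holds`)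
  and the boundary-condition independence of the density
  (`ChatterjeeFreeEnergy.tendsto_freeEnergyPerSite_halfOpenBox`); the tree's own reduction
  `chatterjee_freeEnergyDensity_of` is the case `d = 4`, repeated here verbatim for general `d`.
* `weakCoupling_meanAction` — **the mean action per site at weak coupling**: for `d ≥ 2`, `N ≥ 1`
  and every unitary model,
  `∀ ε > 0, ∀ᶠ β → ∞, ∀ᶠ L → ∞, |β ⟨S⟩_{Λ_L, β} / L^d - (d-1) N²/2| ≤ ε`,
  i.e. `β` times the mean Wilson action per site of the torus `(ℤ/Lℤ)^d` tends to `(d-1)N²/2`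
  (per plaquette: `β ⟨N - Re tr U_p⟩ → N²/d`, the value `½ N² · (2/d)` of the lattice Maxwell
  (Gaussian) theory with `N²` real field components per link — "local Gaussianity at weak
  coupling" for the first moment). Ingredients: the two bullets above, the tree's Gibbs–Jensen
  supporting-line inequality `mul_wilsonExpectation_wilsonAction_le` (`WilsonEnergyConvexity`) and
  the existence of the torus free energy density (`exists_hasFreeEnergyDensity_holds`).

Why it is on the path and not beside it: the summit (`YangMills`) asks, along a weak-coupling
sequence `β_k → ∞`, for a volume-uniform lattice mass gap; any proof must in particular control
the local state of the lattice theory at large FIXED `β` uniformly in `L`. The theorem is the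
zeroth item of that control — the one-point function — and it is obtained by the only mechanism
presently available uniformly in the volume at weak coupling (free energy + convexity), certified
in the kernel. It says nothing about correlations (the open infrared content IR-1 of the soloist's
obstruction file); it is the `k = 1` case of the "local Gaussianity" Theorem A of the soloist's
paper, whose `k ≥ 2` cases need Brascamp–Lieb and DLR technology absent from the tree.

References: S. Chatterjee, *The leading term of the Yang–Mills free energy*, J. Funct. Anal. 271
(2016) 2944–3005, arXiv:1602.01222, Thm. 2.1; S. Friedli, Y. Velenik, *Statistical Mechanics of
Lattice Systems* (CUP 2017), Thm. 3.6 and App. B (convexity; Griffiths' lemma); E. Seiler, LNP 159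
(1982), Ch. 2.
-/

open MeasureTheory Filter Topology
open Literature.MathematicalPhysics.QuantumFieldTheory Literature.MathematicalPhysics.QuantumLattice

noncomputable section

namespace Summit.QuantumFields.YangMills.Theorems.SoloBlind

/-! ### The real-analysis lever: supporting lines + a logarithmic asymptote -/

/-- **Griffiths' lemma, scale-invariant form.** If `f_L(β) → f(β)` for every `β`, `E_L(β)`
satisfies the supporting-line inequalities `(β - β') E_L(β) ≤ f_L(β') - f_L(β)` for all
`L, β, β'`, and `f(β) + c log β → K` as `β → ∞` with `c > 0`, then
`∀ ε > 0, ∀ᶠ β → ∞, ∀ᶠ L → ∞, |β E_L(β) - c| ≤ ε`. Proof: apply the two inequalities with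
`β' = (1 ∓ η) β` and use `-log(1-η) ≤ η + 2η²`, `log(1+η) ≥ η - η²` for `0 < η ≤ ½`. [folklore] -/
theorem eventually_abs_mul_sub_le_of_supportingLines
    {fL E : ℕ → ℝ → ℝ} {f : ℝ → ℝ} {c K : ℝ} (hc : 0 < c)
    (hf : ∀ β, Tendsto (fun L => fL L β) atTop (𝓝 (f β)))
    (hJ : ∀ L β β', (β - β') * E L β ≤ fL L β' - fL L β)
    (hg : Tendsto (fun β => f β + c * Real.log β) atTop (𝓝 K)) :
    ∀ ε > 0, ∀ᶠ β in atTop, ∀ᶠ L in atTop, |β * E L β - c| ≤ ε := by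
  intro ε hε
  -- the relative step `η` and the tolerance `θ`
  obtain ⟨η, hη0, hη2, hcη⟩ : ∃ η : ℝ, 0 < η ∧ η ≤ 1 / 2 ∧ c * η ≤ ε / 4 := by
    refine ⟨min (1 / 2) (ε / (4 * c)), lt_min (by norm_num) (by positivity), min_le_left _ _, ?_⟩
    calc c * min (1 / 2) (ε / (4 * c)) ≤ c * (ε / (4 * c)) :=
          mul_le_mul_of_nonneg_left (min_le_right _ _) hc.le
      _ = ε / 4 := by field_simp
  set θ : ℝ := η * ε / 12 with hθ
  have hθ0 : 0 < θ := by positivity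
  -- two elementary logarithm bounds
  have hm : -Real.log (1 - η) ≤ η + 2 * η ^ 2 := by
    have h1 : 1 - (1 - η)⁻¹ ≤ Real.log (1 - η) := Real.one_sub_inv_le_log_of_pos (by linarith)
    have h2 : (1 - η)⁻¹ ≤ 1 + η + 2 * η ^ 2 := by
      rw [inv_eq_one_div, div_le_iff₀ (by linarith)]
      nlinarith [sq_nonneg η, mul_nonneg hη0.le (sq_nonneg η)]
    linarith
  have hp : η - η ^ 2 ≤ Real.log (1 + η) := by
    have h1 : 1 - (1 + η)⁻¹ ≤ Real.log (1 + η) := Real.one_sub_inv_le_log_of_pos (by linarith)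
    have h2 : (1 + η)⁻¹ ≤ 1 - η + η ^ 2 := by
      rw [inv_eq_one_div, div_le_iff₀ (by linarith)]
      nlinarith [sq_nonneg η, mul_nonneg hη0.le (sq_nonneg η)]
    linarith
  -- `β` large: `β ≥ 1` and `(1 - η) β ≥ β₀`, where `|f β' + c log β' - K| < θ` for `β' ≥ β₀`
  obtain ⟨β₀, hβ₀⟩ := (Metric.tendsto_atTop.1 hg) θ hθ0
  have hev : ∀ᶠ β : ℝ in atTop, 1 ≤ β ∧ β₀ ≤ (1 - η) * β :=
    (eventually_ge_atTop 1).and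
      ((tendsto_id.const_mul_atTop (by linarith : (0 : ℝ) < 1 - η)).eventually_ge_atTop β₀)
  filter_upwards [hev] with β ⟨hβ1, hβ₀'⟩
  have hβ0 : 0 < β := by linarith
  have hβa : β₀ ≤ β := hβ₀'.trans (by nlinarith)
  have hβb : β₀ ≤ (1 + η) * β := hβa.trans (by nlinarith)
  have hg1 := hβ₀ β hβa
  have hg2 := hβ₀ _ hβ₀'
  have hg3 := hβ₀ _ hβb
  rw [Real.dist_eq] at hg1 hg2 hg3
  have hlog2 : Real.log ((1 - η) * β) = Real.log (1 - η) + Real.log β :=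
    Real.log_mul (by linarith : (0 : ℝ) < 1 - η).ne' hβ0.ne'
  have hlog3 : Real.log ((1 + η) * β) = Real.log (1 + η) + Real.log β :=
    Real.log_mul (by linarith : (0 : ℝ) < 1 + η).ne' hβ0.ne'
  rw [hlog2] at hg2
  rw [hlog3] at hg3
  -- `L` large: the three finite-volume free energies are within `θ` of their limits
  have e : ∀ b : ℝ, ∀ᶠ L : ℕ in atTop, |fL L b - f b| < θ := fun b => by
    have h := (Metric.tendsto_nhds.1 (hf b)) θ hθ0
    simpa only [Real.dist_eq] using h
  filter_upwards [e β, e ((1 - η) * β), e ((1 + η) * β)] with L h1 h2 h3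
  -- the two supporting lines at `β`, evaluated at `β' = (1 ∓ η) β`
  have hJu := hJ L β ((1 - η) * β)
  have hJl := hJ L β ((1 + η) * β)
  rw [show (β - (1 - η) * β) = η * β by ring] at hJu
  rw [show (β - (1 + η) * β) = -(η * β) by ring] at hJl
  obtain ⟨h1a, h1b⟩ := abs_lt.1 h1
  obtain ⟨h2a, h2b⟩ := abs_lt.1 h2
  obtain ⟨h3a, h3b⟩ := abs_lt.1 h3
  obtain ⟨g1a, g1b⟩ := abs_lt.1 hg1
  obtain ⟨g2a, g2b⟩ := abs_lt.1 hg2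
  obtain ⟨g3a, g3b⟩ := abs_lt.1 hg3
  have hcm : c * (-Real.log (1 - η)) ≤ c * (η + 2 * η ^ 2) := mul_le_mul_of_nonneg_left hm hc.le
  have hcp : c * (η - η ^ 2) ≤ c * Real.log (1 + η) := mul_le_mul_of_nonneg_left hp hc.le
  have hηc2 : η * (c * η) ≤ η * (ε / 4) := mul_le_mul_of_nonneg_left hcη hη0.le
  have hηε : 0 < η * ε := mul_pos hη0 hε
  -- upper bound: `η β E ≤ 4θ - c log(1-η) ≤ η (c + ε)`
  have hup : η * (β * E L β) ≤ η * (c + ε) := by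
    have : η * β * E L β ≤ 4 * θ + c * (-Real.log (1 - η)) := by linarith
    nlinarith
  -- lower bound: `η β E ≥ c log(1+η) - 4θ ≥ η (c - ε)`
  have hlo : η * (c - ε) ≤ η * (β * E L β) := by
    have : c * Real.log (1 + η) - 4 * θ ≤ η * β * E L β := by linarith
    nlinarith
  rw [abs_le]
  constructor
  · have := le_of_mul_le_mul_left hlo hη0
    linarith
  · have := le_of_mul_le_mul_left hup hη0
    linarith

/-! ### Chatterjee's leading term in the torus normalisation, every `d ≥ 2` -/

variable {d N : ℕ} {G : Type} [Group G] [TopologicalSpace G] [IsTopologicalGroup G]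
  [CompactSpace G] [MeasurableSpace G] [BorelSpace G]

/-- **Chatterjee's theorem for tori, general dimension.** For `d ≥ 2`, `N ≥ 1` and a unitary
model `ρ : G →* M_N(ℂ)` (`IsUnitaryModel ρ`), the torus free energy density
`f(β) = lim_L L^{-d} log Z_{Λ_L, β}` satisfies `f(β) + ½ (d-1) N² log β → K` as `β → ∞` for some
real `K` (`= (d-1) log(∏_{j<N} j!/(2π)^{N/2}) + N² K_d`). The case `d = 4` is the tree's
`chatterjee_freeEnergyDensity_of`; the proof is the same: the printed joint limit on free cubes
(`chatterjee_freeEnergy_holds`), boundary-condition independence at fixed `β`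
(`ChatterjeeFreeEnergy.tendsto_freeEnergyPerSite_halfOpenBox`) and the filter fact
`ChatterjeeFreeEnergy.tendsto_of_tendsto_prod_atTop`. [cite: arXiv160201222, Thm. 2.1 and Lemma 17.5] -/
theorem tendsto_freeEnergyDensity_add_log [SecondCountableTopology G]
    (ρ : G →* Matrix (Fin N) (Fin N) ℂ) (hd : 2 ≤ d) (hN : 1 ≤ N) (hρ : IsUnitaryModel ρ) :
    ∃ K : ℝ, Tendsto (fun β : ℝ =>
      freeEnergyDensity d ρ β + 1 / 2 * ((d : ℝ) - 1) * ((N : ℝ) ^ 2 * Real.log β)) atTop (𝓝 K) := by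
  have hρc : Continuous ρ := hρ.1
  obtain ⟨K, hK⟩ := chatterjee_freeEnergy_holds d hd
  have hjoint := hK N hN G ρ hρ
  refine ⟨_, ChatterjeeFreeEnergy.tendsto_of_tendsto_prod_atTop hjoint fun β => ?_⟩
  have h1 := ChatterjeeFreeEnergy.tendsto_freeEnergyPerSite_halfOpenBox (d := d) ρ hρc β
  have h2 := ChatterjeeFreeEnergy.tendsto_coeff (m := d) (by omega) (1 / 2 : ℝ)
    ((N : ℝ) ^ 2 * Real.log β)
  have h3 := h1.add h2
  refine h3.congr fun n => ?_
  simp only [mul_assoc]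

/-! ### The mean action per site at weak coupling -/

/-- **The mean plaquette of `U(N)` lattice gauge theory at weak coupling, uniformly in the
volume.** For `d ≥ 2`, `N ≥ 1` and every unitary model `ρ : G →* M_N(ℂ)` (`G ≅ U(N)` onto its
defining representation): for every `ε > 0`, for all sufficiently large `β` and then all
sufficiently large tori `Λ_{L+1} = (ℤ/(L+1)ℤ)^d`,
`|β ⟨S⟩_{Λ_{L+1}, β} / (L+1)^d - (d-1) N²/2| ≤ ε`, where `S = ∑_p (N - Re tr ρ(U_p))` is the
Wilson action and `⟨·⟩_{Λ, β}` the Wilson state (`wilsonExpectation`). Equivalently, per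
plaquette (there are `d(d-1)/2` per site), `β ⟨N - Re tr ρ(U_p)⟩ → N²/d`: the lattice Maxwell
value. Proof: `eventually_abs_mul_sub_le_of_supportingLines` with `f_L(β) = (L+1)^{-d} log
Z_{Λ_{L+1}, β}` (converging to `freeEnergyDensity d ρ β`, `exists_hasFreeEnergyDensity_holds`),
`E_L(β) = (L+1)^{-d} ⟨S⟩_{Λ_{L+1}, β}` (supporting lines: `mul_wilsonExpectation_wilsonAction_le`),
`c = (d-1)N²/2` and Chatterjee's theorem (`tendsto_freeEnergyDensity_add_log`).
[cite: arXiv160201222, Thm. 2.1; FriedliVelenik2017, Thm. 3.6 and App. B.8] -/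
theorem weakCoupling_meanAction (ρ : G →* Matrix (Fin N) (Fin N) ℂ) (hd : 2 ≤ d) (hN : 1 ≤ N)
    (hρ : IsUnitaryModel ρ) :
    ∀ ε > 0, ∀ᶠ β : ℝ in atTop, ∀ᶠ L : ℕ in atTop,
      |β * wilsonExpectation ρ β (wilsonAction (d := d) (L := L + 1) (G := G) ρ) /
          ((L + 1 : ℕ) : ℝ) ^ d - ((d : ℝ) - 1) * (N : ℝ) ^ 2 / 2| ≤ ε := by
  have hρc : Continuous ρ := hρ.1
  haveI : SecondCountableTopology (Matrix (Fin N) (Fin N) ℂ) :=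
    inferInstanceAs (SecondCountableTopology (Fin N → Fin N → ℂ))
  haveI : SecondCountableTopology G :=
    (hρc.isClosedEmbedding hρ.2.1).isEmbedding.secondCountableTopology
  set c : ℝ := 1 / 2 * ((d : ℝ) - 1) * (N : ℝ) ^ 2 with hc
  have hc0 : 0 < c := by
    have hd' : (2 : ℝ) ≤ d := by exact_mod_cast hd
    have hN' : (1 : ℝ) ≤ N := by exact_mod_cast hN
    have : 0 < (N : ℝ) ^ 2 := by positivity
    rw [hc]
    exact mul_pos (mul_pos (by norm_num) (by linarith)) this
  obtain ⟨K, hK⟩ := tendsto_freeEnergyDensity_add_log ρ hd hN hρ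
  have hg : Tendsto (fun β : ℝ => freeEnergyDensity d ρ β + c * Real.log β) atTop (𝓝 K) := by
    refine hK.congr fun β => ?_
    rw [hc]
    ring
  have hf : ∀ β : ℝ, Tendsto (fun L : ℕ => (((L + 1 : ℕ) : ℝ) ^ d)⁻¹ * torusLogPartition d ρ β (L + 1))
      atTop (𝓝 (freeEnergyDensity d ρ β)) := fun β =>
    hasFreeEnergyDensity_freeEnergyDensity ρ (exists_hasFreeEnergyDensity_holds (d := d) ρ hρc β)
  have hJ : ∀ (L : ℕ) (β β' : ℝ),
      (β - β') * ((((L + 1 : ℕ) : ℝ) ^ d)⁻¹ *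
          wilsonExpectation ρ β (wilsonAction (d := d) (L := L + 1) (G := G) ρ)) ≤
        (((L + 1 : ℕ) : ℝ) ^ d)⁻¹ * torusLogPartition d ρ β' (L + 1) -
          (((L + 1 : ℕ) : ℝ) ^ d)⁻¹ * torusLogPartition d ρ β (L + 1) := by
    intro L β β'
    have h := mul_wilsonExpectation_wilsonAction_le (d := d) (L := L + 1) ρ hρc β β'
    have hs : (0 : ℝ) ≤ (((L + 1 : ℕ) : ℝ) ^ d)⁻¹ := by positivity
    have h' := mul_le_mul_of_nonneg_left h hs
    rw [← mul_sub]
    calc (β - β') * ((((L + 1 : ℕ) : ℝ) ^ d)⁻¹ *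
            wilsonExpectation ρ β (wilsonAction (d := d) (L := L + 1) (G := G) ρ))
          = (((L + 1 : ℕ) : ℝ) ^ d)⁻¹ * ((β - β') *
            wilsonExpectation ρ β (wilsonAction (d := d) (L := L + 1) (G := G) ρ)) := by ring
      _ ≤ _ := h'
  have hmain := eventually_abs_mul_sub_le_of_supportingLines
    (E := fun (L : ℕ) (β : ℝ) => (((L + 1 : ℕ) : ℝ) ^ d)⁻¹ *
      wilsonExpectation ρ β (wilsonAction (d := d) (L := L + 1) (G := G) ρ)) hc0 hf hJ hg
  intro ε hε
  filter_upwards [hmain ε hε] with β hβ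
  filter_upwards [hβ] with L hL
  have h1 : β * wilsonExpectation ρ β (wilsonAction (d := d) (L := L + 1) (G := G) ρ) /
        ((L + 1 : ℕ) : ℝ) ^ d =
      β * ((((L + 1 : ℕ) : ℝ) ^ d)⁻¹ *
        wilsonExpectation ρ β (wilsonAction (d := d) (L := L + 1) (G := G) ρ)) := by ring
  have h2 : ((d : ℝ) - 1) * (N : ℝ) ^ 2 / 2 = c := by
    rw [hc]
    ring
  rw [h1, h2]
  exact hL

/-! ### Per plaquette: `β ⟨N - Re tr ρ(U_p)⟩ → N²/d` -/

/-- The number of coordinate planes `{(i, j) : i < j}` of `Fin d × Fin d` is `d(d-1)/2`: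
`2 · #{i < j} = d² - d` (the strict upper and lower triangles are in bijection by the swap and
together form the off-diagonal). [folklore] -/
theorem two_mul_card_planes (d : ℕ) :
    2 * Fintype.card {q : Fin d × Fin d // q.1 < q.2} = d * d - d := by
  classical
  set s : Finset (Fin d × Fin d) := Finset.univ.filter fun q => q.1 < q.2 with hs
  set t : Finset (Fin d × Fin d) := Finset.univ.filter fun q => q.2 < q.1 with ht
  have hcard : Fintype.card {q : Fin d × Fin d // q.1 < q.2} = s.card := Fintype.card_subtype _
  have hst : t.card = s.card := by
    refine Finset.card_equiv (Equiv.prodComm (Fin d) (Fin d)) fun q => ?_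
    simp only [ht, hs, Finset.mem_filter, Finset.mem_univ, true_and, Equiv.prodComm_apply,
      Prod.fst_swap, Prod.snd_swap]
  have hunion : s ∪ t = (Finset.univ : Finset (Fin d)).offDiag := by
    ext q
    simp only [hs, ht, Finset.mem_union, Finset.mem_filter, Finset.mem_univ, true_and,
      Finset.mem_offDiag]
    exact ⟨fun h => h.elim ne_of_lt fun h' => (ne_of_lt h').symm, fun h => lt_or_gt_of_ne h⟩
  have hdisj : Disjoint s t := by
    rw [hs, ht, Finset.disjoint_filter]
    exact fun q _ h1 h2 => lt_asymm h1 h2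
  have hu := Finset.card_union_of_disjoint hdisj
  rw [hunion, Finset.offDiag_card, Finset.card_univ, Fintype.card_fin, hst] at hu
  omega

/-- As a real number, `#{(i, j) : i < j} = d(d-1)/2`. [folklore] -/
theorem card_planes_eq (d : ℕ) :
    (Fintype.card {q : Fin d × Fin d // q.1 < q.2} : ℝ) = (d : ℝ) * ((d : ℝ) - 1) / 2 := by
  have h := two_mul_card_planes d
  have hle : d ≤ d * d := Nat.le_mul_self d
  have h' : 2 * (Fintype.card {q : Fin d × Fin d // q.1 < q.2} : ℝ) = (d : ℝ) * d - d := by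
    have := congrArg (fun n : ℕ => (n : ℝ)) h
    simpa [Nat.cast_sub hle] using this
  linarith

/-- The torus `(ℤ/Lℤ)^d` has `L^d · d(d-1)/2` plaquettes. [folklore] -/
theorem card_plaquette_eq (d L : ℕ) [NeZero L] :
    (Fintype.card (Plaquette d L) : ℝ) = (L : ℝ) ^ d * ((d : ℝ) * ((d : ℝ) - 1) / 2) := by
  rw [← card_planes_eq]
  simp [Plaquette, Site, Fintype.card_prod, Fintype.card_pi, ZMod.card, Finset.prod_const,
    Finset.card_univ, Fintype.card_fin]

/-- **The mean plaquette at weak coupling, per plaquette.** For `d ≥ 2`, `N ≥ 1` and every unitary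
model: for every `ε > 0`, for all large `β` and then all large tori,
`|β ⟨S⟩_{Λ_{L+1}, β} / #plaquettes(Λ_{L+1}) - N²/d| ≤ ε` — `β` times the mean cost
`N - Re tr ρ(U_p)` of a plaquette tends to `N²/d`, the value of the lattice Maxwell theory
(`½ N²` times the diagonal `2/d` of the `L²(ℤ^d)`-projection onto `ran d`). [cite: arXiv160201222, Thm. 2.1] -/
theorem weakCoupling_meanPlaquette (ρ : G →* Matrix (Fin N) (Fin N) ℂ) (hd : 2 ≤ d) (hN : 1 ≤ N)
    (hρ : IsUnitaryModel ρ) :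
    ∀ ε > 0, ∀ᶠ β : ℝ in atTop, ∀ᶠ L : ℕ in atTop,
      |β * wilsonExpectation ρ β (wilsonAction (d := d) (L := L + 1) (G := G) ρ) /
          (Fintype.card (Plaquette d (L + 1)) : ℝ) - (N : ℝ) ^ 2 / d| ≤ ε := by
  intro ε hε
  set P : ℝ := (d : ℝ) * ((d : ℝ) - 1) / 2 with hP
  have hd' : (2 : ℝ) ≤ d := by exact_mod_cast hd
  have hP1 : 1 ≤ P := by
    rw [hP]
    nlinarith
  have hP0 : 0 < P := by linarith
  filter_upwards [weakCoupling_meanAction ρ hd hN hρ (ε * P) (by positivity)] with β hβ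
  filter_upwards [hβ] with L hL
  set W : ℝ := β * wilsonExpectation ρ β (wilsonAction (d := d) (L := L + 1) (G := G) ρ) with hW
  have hs : (0 : ℝ) < ((L + 1 : ℕ) : ℝ) ^ d := by positivity
  rw [card_plaquette_eq, ← hP]
  have hd1 : (d : ℝ) - 1 ≠ 0 := (by linarith : (0 : ℝ) < d - 1).ne'
  have hd0 : (d : ℝ) ≠ 0 := (by linarith : (0 : ℝ) < d).ne'
  have h1 : W / ((((L + 1 : ℕ) : ℝ)) ^ d * P) - (N : ℝ) ^ 2 / d =
      (W / ((L + 1 : ℕ) : ℝ) ^ d - ((d : ℝ) - 1) * (N : ℝ) ^ 2 / 2) / P := by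
    rw [hP]
    field_simp
  rw [show ((↑(L + 1 : ℕ) : ℝ)) ^ d * P = (((L + 1 : ℕ) : ℝ)) ^ d * P from rfl, h1, abs_div,
    abs_of_pos hP0, div_le_iff₀ hP0]
  exact hL

end Summit.QuantumFields.YangMills.Theorems.SoloBlind
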